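/-
Copyright (c) 2026 the pub-hodgecm-mathlib formalisation cell (harness21).  Prover seat hodgecm-mathlib-F0P2-p02 (g25); E1 keeper ∕ dealer F0P3a-p03 (g29), E1 BRICK
LEDGER row 27 «COMPACT-PICTURE JET @ DATUM», DELIVERABLE 2 FILE J2 = the datum dress of ★ J1 `Literature.NumberTheory.Automorphic.SmoothInductionUnipotentModelJet`
(SIGSHEET «=» 2026-09-03T00:47:18Z: «J2 `Theorems/F0P3cStCharTSJetAtDatum.lean` with `Λ` as the datum's hypothesis until the ★ `iwasawaExp` transport is wanted»).
-/
import Literature.NumberTheory.Automorphic.SmoothInductionUnipotentModelJet   -- ★ J1 p853177: `Representation.exists_linearEquiv_smoothInd_unipotentModel_jet` (generic: `Ind_H^G ρN ≅` the jet module of `(Ind_H^G σ, π₁)`)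
import Literature.NumberTheory.Automorphic.UnitaryGroupBorelInduction        -- ★ `cmBorelTriple`, `cmPrincipalSeries`, `locallyCompactSpace_cmBorelU` (brings ★ `JacquetModule`: `ParabolicTriple`, `normalizedInd`, `rootDeltaChar`)
import HarnessLib

/-!
# The unipotent-model jet AT THE CM DATUM: `i_B(σ₀ ⊗ [[1, λ],[0, 1]]) ≅` the jet module of `(i_B σ₀, π₁)` for `G = U(Φ_N)(L⁺_v)`, `B = TN = cmBorelTriple L N v`,
# `(π₁ g v)(x) = (Λ(xg) − Λ(x))·v(xg)` — normalised induction `i_B = normalizedInd`, the height `Λ` a HYPOTHESIS of the datum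

Cell `pub/hodgecm-mathlib`, crux H413 = `stmt-HodgeConjecture-24833` (`--supports` lane, helper, THEOREMS ONLY: no definition ∕ instance ∕ notation ∕ named fact ∕ `sorry`).
Namespace `Summit.HodgeConjecture.HodgeConjecture.Cruxes.H413.F0P3cStCharTSJetAtDatum`.  E1 BRICK LEDGER (F0P3a-p03 (g29)) row 27 «COMPACT-PICTURE JET @ DATUM», file J2
(census `CENSUS-JET-AT-DATUM.v1` 35cdd4c6 (β): the tree has NO compact picture `i_B σ|_K`; the Iwasawa height does the same job): the ORGAN-SIDE identification
«`Ĩ = i_B(N_χ)` IS the jet module of the first-order deformation `(i_B χ, π₁)`» of the K4′ Ext-free spine (MEMO v2 0160dcb7) and of the K2′-π² cell, obtained by dressing ★ J1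
(`Representation.exists_linearEquiv_smoothInd_unipotentModel_jet`, bare smooth induction `Ind_H^G`) in two steps:
* §1 (any topological group `G`, any parabolic triple `t`, `[LocallyCompactSpace t.P]`): NORMALISED induction `i_t σ₀ = Ind_{t.P}^G (σ₀ ∘ proj ⊗ δ_P^{1/2})` (★ `normalizedInd`).  For
  `σ₀ : Representation ℂ t.M W`, `λ : t.M → ℂ` and the `t.M`-level jet `N₀` (`N₀ m (w₁, w₂) = (σ₀ m w₁, λ(m) σ₀ m w₁ + σ₀ m w₂)`, JET-SIGN's lower-triangular letters; `W = ℂ`,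
  `σ₀ = χ`: the unipotent model `χ ⊗ [[1, λ],[0, 1]]`), the inflated-twisted pair `(σ₀ ∘ proj ⊗ δ^{1/2}, N₀ ∘ proj ⊗ δ^{1/2})` is again a jet pair at the `t.P`-level with `λ ∘ proj`
  (`twist_comp_proj_unipotentModel_apply` — `δ^{1/2}` is a scalar and commutes with `λ`), so ★ J1 applies with `H := t.P`: **`exists_linearEquiv_normalizedInd_unipotentModel_jet`** —
  `i_t N₀ ≅` (by the height trivialisation `Ψ F = (F₁, F₂ − Λ·F₁)`) the jet module (★ JET-SIGN `exists_representation_jet`) of `(i_t σ₀, π₁)`, `(π₁ g v)(x) = (Λ(xg) − Λ(x))·v(xg)`, for any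
  HEIGHT `Λ : G → ℂ`, `Λ(p g) = λ(proj p) + Λ(g)`, right-invariant under an open subgroup.
* §2 the CM DATUM `G = ↥(unitaryGroupOfForm (conjLocal L c v) (cmLocalForm L N v))`, `t := cmBorelTriple L N v` (`B = TN`, `t.M = torusU`, `t.P = borelU` reducibly), instance binder
  `[LocallyCompactSpace ↥(borelU …)]` (discharged by ★ `locallyCompactSpace_cmBorelU L N v` at any use site; a `Prop`, proof-irrelevant) exactly as ★ FN @ DATUM
  (`F0P3cStCharTSFrobeniusNaturality`): **`exists_linearEquiv_normalizedInd_cmBorel_unipotentModel_jet`** (any `σ₀` on `T(L⁺_v)`), and for a CHARACTER `χ` of the torus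
  **`exists_linearEquiv_cmPrincipalSeries_unipotentModel_jet`** — `i_B(χ ⊗ [[1, λ],[0, 1]]) ≅` the jet module of `(i_G(χ), π₁)`, `i_G(χ) = normalizedInd (cmBorelTriple L N v) ((trivial ℂ T ℂ).twist χ)`
  (which IS ★ `cmPrincipalSeries L N v χ` by `rfl`, ★ FN @ DATUM `cmPrincipalSeries_eq_normalizedInd`; torus objects typed over `T = (cmBorelTriple L N v).M`, see §3).
The height `Λ` stays a HYPOTHESIS of the datum (p03 00:47:18Z): its instance is the Iwasawa height `t ↦ λ(a(g))` of `G = BK₀` (★ `HyperspecialUnitaryIwasawaExponents`), right-`K₀`-invariant,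
to be transported along ★ `localNonsplitEquiv` when a consumer wants it.  CONSUMERS: JET-WINDOW ★ `FirstOrderDeformationInvariantSubspace` (row 21) and TRANSVERSAL (row 26) at
`π₀ := cmPrincipalSeries L N v χ`, this `π₁`; the K4′ spine's organ-side line «`Ĩ = i_B(N_χ)` = the jet module of `s ↦ i_B(χν^s)`».  HONEST LABEL: count-neutral helper; h413 OPEN; HC_CM is
proved only modulo the 7 printed citations (2 remaining named inputs hLiu418 = stmt-HodgeConjecture-24832, h413 = stmt-HodgeConjecture-24833) until rung 0 closes.

## References
* [BernsteinZelevinsky1977] I. N. Bernstein, A. V. Zelevinsky, *Induced representations of reductive p-adic groups I*, Ann. Sci. ÉNS 10 (1977), §1.9, §2.3.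
* [Keys1984] D. Keys, *Principal series representations of special unitary groups over local fields*, Compositio Math. 51 (1984), §3 pp. 118–119.
* [Rogawski1990] J. Rogawski, *Automorphic representations of unitary groups in three variables*, Ann. of Math. Stud. 123 (1990), §12.2 p. 173.
-/

set_option autoImplicit false

noncomputable section

open NumberField IsDedekindDomain

set_option linter.dupNamespace false

namespace Summit.HodgeConjecture.HodgeConjecture.Cruxes.H413.F0P3cStCharTSJetAtDatum

open Literature.NumberTheory.Automorphic Literature.NumberTheory.Automorphic.UnitaryGroup Representation

/-! ## §1 Normalised induction from any parabolic triple commutes with the unipotent-model jet -/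

section AnyTriple

variable {G : Type*} [Group G] [TopologicalSpace G] [IsTopologicalGroup G] (t : ParabolicTriple G) [LocallyCompactSpace ↥t.P]
  {W : Type*} [AddCommGroup W] [Module ℂ W]
  (σ₀ : Representation ℂ ↥t.M W) (lam : ↥t.M → ℂ) (N₀ : Representation ℂ ↥t.M (W × W))
  (hN₀ : ∀ (m : ↥t.M) (w : W × W), N₀ m w = (σ₀ m w.1, lam m • σ₀ m w.1 + σ₀ m w.2))
  (Λ : G → ℂ) (hΛ : ∀ (p : ↥t.P) (g : G), Λ ((p : G) * g) = lam (t.proj p) + Λ g)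
  (KΛ : Subgroup G) (hKΛ : IsOpen (KΛ : Set G)) (hΛK : ∀ (x κ : G), κ ∈ KΛ → Λ (x * κ) = Λ x)

include hN₀ in
/-- Inflating along `proj : P → M` and twisting by the scalar `δ_P^{1/2}` PRESERVES the jet shape: `(N₀ ∘ proj ⊗ δ^{1/2}) p (w₁, w₂) = (σ p w₁, λ(proj p) σ p w₁ + σ p w₂)` with
`σ := σ₀ ∘ proj ⊗ δ^{1/2}` (the scalar `δ^{1/2}(p)` commutes with `λ(proj p)`). [cite: BernsteinZelevinsky1977, §2.3] -/
theorem twist_comp_proj_unipotentModel_apply (p : ↥t.P) (w : W × W) :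
    Representation.twist (N₀.comp t.proj) (rootDeltaChar t.P) p w =
      (Representation.twist (σ₀.comp t.proj) (rootDeltaChar t.P) p w.1,
        lam (t.proj p) • Representation.twist (σ₀.comp t.proj) (rootDeltaChar t.P) p w.1 +
          Representation.twist (σ₀.comp t.proj) (rootDeltaChar t.P) p w.2) := by
  refine Prod.ext ?_ ?_
  · simp only [Representation.twist_apply, MonoidHom.coe_comp, Function.comp_apply, hN₀, Prod.smul_fst]
  · simp only [Representation.twist_apply, MonoidHom.coe_comp, Function.comp_apply, hN₀, Prod.smul_snd, smul_add]
    rw [smul_comm]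

include hN₀ hΛ hKΛ hΛK in
/-- **`i_t(σ₀ ⊗ [[1, λ],[0, 1]]) ≅ THE JET MODULE OF `(i_t σ₀, π₁)` — normalised induction commutes with the unipotent-model jet.**  For any parabolic triple `t` of a topological group `G`,
`σ₀`, `λ`, the `t.M`-level jet `N₀` of `(σ₀, λ•σ₀)` and a HEIGHT `Λ` (`Λ(p g) = λ(proj p) + Λ(g)`, right-invariant under an open subgroup): there are the height trivialisation
`Ψ : i_t N₀ ≃ i_t σ₀ × i_t σ₀` (`Ψ F = (F₁, F₂ − Λ·F₁)` on underlying functions), `π₁ : G → End (i_t σ₀)` with `(π₁ g v)(x) = (Λ(xg) − Λ(x))·v(xg)`, `π₁ 1 = 0`, the Leibniz rule, and the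
jet representation `ρ` of `(i_t σ₀, π₁)` (★ JET-SIGN letters) with `Ψ ∘ i_t N₀ (g) = ρ g ∘ Ψ`.  ★ J1 `exists_linearEquiv_smoothInd_unipotentModel_jet` at `H := t.P`, `σ := σ₀ ∘ proj ⊗ δ^{1/2}`
(★ `normalizedInd t σ₀ = smoothIndRep t.P (σ₀ ∘ proj ⊗ δ^{1/2})` by `rfl`). [cite: BernsteinZelevinsky1977, §1.9, §2.3] [cite: Keys1984, §3 pp. 118–119] -/
theorem exists_linearEquiv_normalizedInd_unipotentModel_jet :
    ∃ (Ψ : SmoothInd t.P (Representation.twist (N₀.comp t.proj) (rootDeltaChar t.P)) ≃ₗ[ℂ]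
        SmoothInd t.P (Representation.twist (σ₀.comp t.proj) (rootDeltaChar t.P)) × SmoothInd t.P (Representation.twist (σ₀.comp t.proj) (rootDeltaChar t.P)))
      (π₁ : G → Module.End ℂ (SmoothInd t.P (Representation.twist (σ₀.comp t.proj) (rootDeltaChar t.P))))
      (ρ : Representation ℂ G
        (SmoothInd t.P (Representation.twist (σ₀.comp t.proj) (rootDeltaChar t.P)) × SmoothInd t.P (Representation.twist (σ₀.comp t.proj) (rootDeltaChar t.P)))),
      (∀ (F : SmoothInd t.P (Representation.twist (N₀.comp t.proj) (rootDeltaChar t.P))) (x : G),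
          ((Ψ F).1).toFun x = (F.toFun x).1 ∧ ((Ψ F).2).toFun x = (F.toFun x).2 - Λ x • (F.toFun x).1) ∧
      (∀ (g : G) (v : SmoothInd t.P (Representation.twist (σ₀.comp t.proj) (rootDeltaChar t.P))) (x : G),
          (π₁ g v).toFun x = (Λ (x * g) - Λ x) • v.toFun (x * g)) ∧
      π₁ 1 = 0 ∧ (∀ g h, π₁ (g * h) = π₁ g * Representation.normalizedInd t σ₀ h + Representation.normalizedInd t σ₀ g * π₁ h) ∧
      (∀ g v₀ v₁, ρ g (v₀, v₁) = (Representation.normalizedInd t σ₀ g v₀, π₁ g v₀ + Representation.normalizedInd t σ₀ g v₁)) ∧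
      ∀ (g : G) (F : SmoothInd t.P (Representation.twist (N₀.comp t.proj) (rootDeltaChar t.P))),
        Ψ (Representation.normalizedInd t N₀ g F) = ρ g (Ψ F) :=
  exists_linearEquiv_smoothInd_unipotentModel_jet t.P (Representation.twist (σ₀.comp t.proj) (rootDeltaChar t.P)) (fun p => lam (t.proj p))
    (Representation.twist (N₀.comp t.proj) (rootDeltaChar t.P)) (twist_comp_proj_unipotentModel_apply t σ₀ lam N₀ hN₀) Λ hΛ KΛ hKΛ hΛK

end AnyTriple

/-! ## §2 The CM datum: `G = U(Φ_N)(L⁺_v)`, `B = TN = cmBorelTriple L N v` -/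

section Datum

variable (L : Type) [Field L] [NumberField L] [IsCMField L] (N : ℕ) (v : HeightOneSpectrum (𝓞 ↥(maximalRealSubfield L)))
  [LocallyCompactSpace ↥(borelU (conjLocal L (IsCMField.complexConj L) v) (cmLocalForm L N v))]
  (Λ : ↥(unitaryGroupOfForm (conjLocal L (IsCMField.complexConj L) v) (cmLocalForm L N v)) → ℂ)
  (KΛ : Subgroup ↥(unitaryGroupOfForm (conjLocal L (IsCMField.complexConj L) v) (cmLocalForm L N v)))
  (hKΛ : IsOpen (KΛ : Set ↥(unitaryGroupOfForm (conjLocal L (IsCMField.complexConj L) v) (cmLocalForm L N v))))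
  (hΛK : ∀ (x κ : ↥(unitaryGroupOfForm (conjLocal L (IsCMField.complexConj L) v) (cmLocalForm L N v))), κ ∈ KΛ → Λ (x * κ) = Λ x)

section AnySigma

variable {W : Type*} [AddCommGroup W] [Module ℂ W]
  (σ₀ : Representation ℂ ↥(cmBorelTriple L N v).M W) (lam : ↥(cmBorelTriple L N v).M → ℂ) (N₀ : Representation ℂ ↥(cmBorelTriple L N v).M (W × W))
  (hN₀ : ∀ (m : ↥(cmBorelTriple L N v).M) (w : W × W), N₀ m w = (σ₀ m w.1, lam m • σ₀ m w.1 + σ₀ m w.2))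
  (hΛ : ∀ (p : ↥(cmBorelTriple L N v).P) (g : ↥(unitaryGroupOfForm (conjLocal L (IsCMField.complexConj L) v) (cmLocalForm L N v))),
    Λ ((p : ↥(unitaryGroupOfForm (conjLocal L (IsCMField.complexConj L) v) (cmLocalForm L N v))) * g) = lam ((cmBorelTriple L N v).proj p) + Λ g)

set_option maxHeartbeats 400000 in
include hN₀ hΛ hKΛ hΛK in
/-- **`i_B(σ₀ ⊗ [[1, λ],[0, 1]]) ≅ THE JET MODULE OF `(i_B σ₀, π₁)` AT THE CM DATUM** (`G = U(Φ_N)(L⁺_v)`, `B = TN = cmBorelTriple L N v`, any `σ₀` on `T(L⁺_v)`, the height `Λ` a hypothesis):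
§1 at `t := cmBorelTriple L N v`. [cite: BernsteinZelevinsky1977, §1.9, §2.3] [cite: Keys1984, §3 pp. 118–119] [cite: Rogawski1990, §12.2 p. 173] -/
theorem exists_linearEquiv_normalizedInd_cmBorel_unipotentModel_jet :
    ∃ (Ψ : SmoothInd (cmBorelTriple L N v).P (Representation.twist (N₀.comp (cmBorelTriple L N v).proj) (rootDeltaChar (cmBorelTriple L N v).P)) ≃ₗ[ℂ]
        SmoothInd (cmBorelTriple L N v).P (Representation.twist (σ₀.comp (cmBorelTriple L N v).proj) (rootDeltaChar (cmBorelTriple L N v).P)) ×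
          SmoothInd (cmBorelTriple L N v).P (Representation.twist (σ₀.comp (cmBorelTriple L N v).proj) (rootDeltaChar (cmBorelTriple L N v).P)))
      (π₁ : ↥(unitaryGroupOfForm (conjLocal L (IsCMField.complexConj L) v) (cmLocalForm L N v)) →
        Module.End ℂ (SmoothInd (cmBorelTriple L N v).P (Representation.twist (σ₀.comp (cmBorelTriple L N v).proj) (rootDeltaChar (cmBorelTriple L N v).P))))
      (ρ : Representation ℂ ↥(unitaryGroupOfForm (conjLocal L (IsCMField.complexConj L) v) (cmLocalForm L N v))
        (SmoothInd (cmBorelTriple L N v).P (Representation.twist (σ₀.comp (cmBorelTriple L N v).proj) (rootDeltaChar (cmBorelTriple L N v).P)) ×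
          SmoothInd (cmBorelTriple L N v).P (Representation.twist (σ₀.comp (cmBorelTriple L N v).proj) (rootDeltaChar (cmBorelTriple L N v).P)))),
      (∀ (F : SmoothInd (cmBorelTriple L N v).P (Representation.twist (N₀.comp (cmBorelTriple L N v).proj) (rootDeltaChar (cmBorelTriple L N v).P)))
          (x : ↥(unitaryGroupOfForm (conjLocal L (IsCMField.complexConj L) v) (cmLocalForm L N v))),
          ((Ψ F).1).toFun x = (F.toFun x).1 ∧ ((Ψ F).2).toFun x = (F.toFun x).2 - Λ x • (F.toFun x).1) ∧
      (∀ (g : ↥(unitaryGroupOfForm (conjLocal L (IsCMField.complexConj L) v) (cmLocalForm L N v)))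
          (w : SmoothInd (cmBorelTriple L N v).P (Representation.twist (σ₀.comp (cmBorelTriple L N v).proj) (rootDeltaChar (cmBorelTriple L N v).P)))
          (x : ↥(unitaryGroupOfForm (conjLocal L (IsCMField.complexConj L) v) (cmLocalForm L N v))), (π₁ g w).toFun x = (Λ (x * g) - Λ x) • w.toFun (x * g)) ∧
      π₁ 1 = 0 ∧
      (∀ g h, π₁ (g * h) = π₁ g * Representation.normalizedInd (cmBorelTriple L N v) σ₀ h + Representation.normalizedInd (cmBorelTriple L N v) σ₀ g * π₁ h) ∧
      (∀ g v₀ v₁, ρ g (v₀, v₁) = (Representation.normalizedInd (cmBorelTriple L N v) σ₀ g v₀, π₁ g v₀ + Representation.normalizedInd (cmBorelTriple L N v) σ₀ g v₁)) ∧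
      ∀ (g : ↥(unitaryGroupOfForm (conjLocal L (IsCMField.complexConj L) v) (cmLocalForm L N v)))
        (F : SmoothInd (cmBorelTriple L N v).P (Representation.twist (N₀.comp (cmBorelTriple L N v).proj) (rootDeltaChar (cmBorelTriple L N v).P))),
        Ψ (Representation.normalizedInd (cmBorelTriple L N v) N₀ g F) = ρ g (Ψ F) :=
  exists_linearEquiv_normalizedInd_unipotentModel_jet (cmBorelTriple L N v) σ₀ lam N₀ hN₀ Λ hΛ KΛ hKΛ hΛK

end AnySigma

/-! ## §3 Characters: `π₀ = i_G(χ) = normalizedInd (cmBorelTriple L N v) ((trivial ℂ T ℂ).twist χ)` (`= cmPrincipalSeries L N v χ` by `rfl`, ★ FN @ DATUM `cmPrincipalSeries_eq_normalizedInd`)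

The torus objects `χ`, `λ`, `N₀` are typed over `T := ↥(cmBorelTriple L N v).M`, which IS `↥(torusU (conjLocal L c v) (cmLocalForm L N v))` reducibly (`cmBorelTriple`, `borelTriple` are
`abbrev`s): a consumer's `χ : ↥(torusU …) →* ℂˣ` is accepted verbatim (one cheap unification), whereas writing `↥(torusU …)` fifteen times in ONE statement next to
`(cmBorelTriple L N v).proj` exhausts the default 200 000 heartbeats at `whnf` (measured on the farm, 2026-09-03) — hence this typing. -/

section Character

variable (χ : ↥(cmBorelTriple L N v).M →* ℂˣ)
  (lam : ↥(cmBorelTriple L N v).M → ℂ)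
  (N₀ : Representation ℂ ↥(cmBorelTriple L N v).M (ℂ × ℂ))
  (hN₀ : ∀ (m : ↥(cmBorelTriple L N v).M) (w : ℂ × ℂ),
    N₀ m w = ((χ m : ℂ) * w.1, lam m * ((χ m : ℂ) * w.1) + (χ m : ℂ) * w.2))
  (hΛ : ∀ (p : ↥(cmBorelTriple L N v).P) (g : ↥(unitaryGroupOfForm (conjLocal L (IsCMField.complexConj L) v) (cmLocalForm L N v))),
    Λ ((p : ↥(unitaryGroupOfForm (conjLocal L (IsCMField.complexConj L) v) (cmLocalForm L N v))) * g) = lam ((cmBorelTriple L N v).proj p) + Λ g)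

omit [LocallyCompactSpace ↥(borelU (conjLocal L (IsCMField.complexConj L) v) (cmLocalForm L N v))] in
include hN₀ in
/-- The character's unipotent model in JET letters: `N₀ m (w₁, w₂) = (χ̃ m w₁, λ(m) χ̃ m w₁ + χ̃ m w₂)` with `χ̃ := (trivial ℂ T ℂ) ⊗ χ` (`χ̃ m a = χ(m) a`). [cite: Keys1984, §3 pp. 118–119] -/
theorem unipotentModel_char_apply (m : ↥(cmBorelTriple L N v).M) (w : ℂ × ℂ) :
    N₀ m w = (((Representation.trivial ℂ ↥(cmBorelTriple L N v).M ℂ).twist χ) m w.1,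
      lam m • ((Representation.trivial ℂ ↥(cmBorelTriple L N v).M ℂ).twist χ) m w.1 +
        ((Representation.trivial ℂ ↥(cmBorelTriple L N v).M ℂ).twist χ) m w.2) := by
  rw [hN₀]
  rfl

set_option maxHeartbeats 400000 in
include hN₀ hΛ hKΛ hΛK in
/-- **`i_B(χ ⊗ [[1, λ],[0, 1]]) ≅ THE JET MODULE OF `(i_G(χ), π₁)`**, `i_G(χ) = normalizedInd (cmBorelTriple L N v) ((trivial ℂ T ℂ).twist χ)` (`= cmPrincipalSeries L N v χ` by `rfl`, ★ FN @ DATUM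
`cmPrincipalSeries_eq_normalizedInd`), for a character `χ` of the
diagonal torus `T(L⁺_v)`, an additive-type datum `λ : T → ℂ`, the unipotent model `N₀` (`N₀ m (w₁, w₂) = (χ(m) w₁, λ(m) χ(m) w₁ + χ(m) w₂)`, JET-SIGN's lower-triangular letters) and a
height `Λ` (`Λ(p g) = λ(proj p) + Λ(g)`, right-invariant under an open subgroup): `Ψ : i_B(N₀) ≃ i_G(χ) × i_G(χ)` (`Ψ F = (F₁, F₂ − Λ·F₁)`), `(π₁ g v)(x) = (Λ(xg) − Λ(x))·v(xg)`, `π₁ 1 = 0`,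
Leibniz, the jet representation `ρ` of `(i_G(χ), π₁)`, `Ψ ∘ i_B(N₀)(g) = ρ g ∘ Ψ` — the organ-side «`Ĩ = i_B(N_χ)` is the jet module of `s ↦ i_B(χν^s)`» WITHOUT a compact picture.
[cite: Keys1984, §3 pp. 118–119] [cite: BernsteinZelevinsky1977, §1.9, §2.3] [cite: Rogawski1990, §12.2 p. 173] -/
theorem exists_linearEquiv_cmPrincipalSeries_unipotentModel_jet :
    ∃ (Ψ : SmoothInd (cmBorelTriple L N v).P (Representation.twist (N₀.comp (cmBorelTriple L N v).proj) (rootDeltaChar (cmBorelTriple L N v).P)) ≃ₗ[ℂ]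
        SmoothInd (cmBorelTriple L N v).P (Representation.twist
            (((Representation.trivial ℂ ↥(cmBorelTriple L N v).M ℂ).twist χ).comp (cmBorelTriple L N v).proj)
            (rootDeltaChar (cmBorelTriple L N v).P)) ×
          SmoothInd (cmBorelTriple L N v).P (Representation.twist
            (((Representation.trivial ℂ ↥(cmBorelTriple L N v).M ℂ).twist χ).comp (cmBorelTriple L N v).proj)
            (rootDeltaChar (cmBorelTriple L N v).P)))
      (π₁ : ↥(unitaryGroupOfForm (conjLocal L (IsCMField.complexConj L) v) (cmLocalForm L N v)) →
        Module.End ℂ (SmoothInd (cmBorelTriple L N v).P (Representation.twist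
            (((Representation.trivial ℂ ↥(cmBorelTriple L N v).M ℂ).twist χ).comp (cmBorelTriple L N v).proj)
            (rootDeltaChar (cmBorelTriple L N v).P))))
      (ρ : Representation ℂ ↥(unitaryGroupOfForm (conjLocal L (IsCMField.complexConj L) v) (cmLocalForm L N v))
        (SmoothInd (cmBorelTriple L N v).P (Representation.twist
            (((Representation.trivial ℂ ↥(cmBorelTriple L N v).M ℂ).twist χ).comp (cmBorelTriple L N v).proj)
            (rootDeltaChar (cmBorelTriple L N v).P)) ×
          SmoothInd (cmBorelTriple L N v).P (Representation.twist
            (((Representation.trivial ℂ ↥(cmBorelTriple L N v).M ℂ).twist χ).comp (cmBorelTriple L N v).proj)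
            (rootDeltaChar (cmBorelTriple L N v).P)))),
      (∀ (F : SmoothInd (cmBorelTriple L N v).P (Representation.twist (N₀.comp (cmBorelTriple L N v).proj) (rootDeltaChar (cmBorelTriple L N v).P)))
          (x : ↥(unitaryGroupOfForm (conjLocal L (IsCMField.complexConj L) v) (cmLocalForm L N v))),
          ((Ψ F).1).toFun x = (F.toFun x).1 ∧ ((Ψ F).2).toFun x = (F.toFun x).2 - Λ x • (F.toFun x).1) ∧
      (∀ (g : ↥(unitaryGroupOfForm (conjLocal L (IsCMField.complexConj L) v) (cmLocalForm L N v)))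
          (w : SmoothInd (cmBorelTriple L N v).P (Representation.twist
            (((Representation.trivial ℂ ↥(cmBorelTriple L N v).M ℂ).twist χ).comp (cmBorelTriple L N v).proj)
            (rootDeltaChar (cmBorelTriple L N v).P)))
          (x : ↥(unitaryGroupOfForm (conjLocal L (IsCMField.complexConj L) v) (cmLocalForm L N v))), (π₁ g w).toFun x = (Λ (x * g) - Λ x) • w.toFun (x * g)) ∧
      π₁ 1 = 0 ∧
      (∀ g h, π₁ (g * h) =
          π₁ g * (Representation.normalizedInd (cmBorelTriple L N v) ((Representation.trivial ℂ ↥(cmBorelTriple L N v).M ℂ).twist χ)) h +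
            (Representation.normalizedInd (cmBorelTriple L N v) ((Representation.trivial ℂ ↥(cmBorelTriple L N v).M ℂ).twist χ)) g * π₁ h) ∧
      (∀ g v₀ v₁, ρ g (v₀, v₁) =
          ((Representation.normalizedInd (cmBorelTriple L N v) ((Representation.trivial ℂ ↥(cmBorelTriple L N v).M ℂ).twist χ)) g v₀,
            π₁ g v₀ + (Representation.normalizedInd (cmBorelTriple L N v) ((Representation.trivial ℂ ↥(cmBorelTriple L N v).M ℂ).twist χ)) g v₁)) ∧
      ∀ (g : ↥(unitaryGroupOfForm (conjLocal L (IsCMField.complexConj L) v) (cmLocalForm L N v)))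
        (F : SmoothInd (cmBorelTriple L N v).P (Representation.twist (N₀.comp (cmBorelTriple L N v).proj) (rootDeltaChar (cmBorelTriple L N v).P))),
        Ψ (Representation.normalizedInd (cmBorelTriple L N v) N₀ g F) = ρ g (Ψ F) :=
  exists_linearEquiv_normalizedInd_cmBorel_unipotentModel_jet L N v Λ KΛ hKΛ hΛK
    ((Representation.trivial ℂ ↥(cmBorelTriple L N v).M ℂ).twist χ) lam N₀ (unipotentModel_char_apply L N v χ lam N₀ hN₀) hΛ

end Character

end Datum

end Summit.HodgeConjecture.HodgeConjecture.Cruxes.H413.F0P3cStCharTSJetAtDatum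

end
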